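import Literature.NumberTheory.Congruences.JacobsthalBinomialCongruence
import Mathlib.Tactic
import HarnessLib

/-!
# Straub 2014, Lemma 5.3 for `λ = (2,2)`: `A(p^r 𝐧; p^s k) ≡ A(p^{r−1} 𝐧; p^{s−1} k) (mod p^{3r})` via Jacobsthal's congruence

Topic `Literature/Combinatorics/Enumerative`, namespace `Literature.Combinatorics.Enumerative.MultivariateAperyPrimePowerProofs`
(sibling of `MultivariateAperyDigitReductionProofs`; both feed `MultivariateAperyPrimePowerProofs`). PROOF FILE:
sorry-free theorems only — no definition, no named fact. Source read on the page (held `paper:arxiv-1401.0854`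
§5): A. Straub, *Multivariate Apéry numbers and supercongruences of rational functions*, Algebra & Number
Theory **8** (2014) [Straub2014]. HONEST FRAMING (cell pub-zeta5): classical congruences; nothing about `ζ(5)`.

## What is printed (verbatim, [Straub2014] Lemma 5.3 and its proof, case `ℓ ≥ 2`, `max(λ₁, …, λ_ℓ) ≤ 2`)

«Lemma 5.3. Let `𝐧 ∈ ℤ^d`, `k ∈ ℤ`, and define (39) `A_λ(𝐧; k) = ∏_{j=1}^{ℓ} C(n_{s(j)+1} + … + n_{s(j)+λ_j}
− (λ_j − 1)k; n_{s(j)+1} − k, …, n_{s(j)+λ_j} − k, k)`. … If `ℓ ≥ 2` and `max(λ₁, …, λ_ℓ) ≤ 2`, then, for primes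
`p ≥ 5` and integers `r ≥ 1`, (40) `A_λ(p^r 𝐧; pk) ≡ A_λ(p^{r−1} 𝐧; k) (mod p^{3r})`.
Proof. We show (40) … by proving that for integers `r, s ≥ 1` and `k` such that `p ∤ k`,
`A_λ(p^r 𝐧; p^s k) ≡ A_λ(p^{r−1} 𝐧; p^{s−1} k) (mod p^{αr})` … each factor … is a single binomial, if `λ_j = 1`,
or of the form `C(m₁, k) C(m₁ + m₂ − k, m₁)`, if `λ_j = 2`. … It follows from Jacobsthal's congruence (41) that
`C(p^r m₁, p^s k)/C(p^{r−1} m₁, p^{s−1} k) ≡ 1 (mod p^{r+s+min(r,s)})` as well as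
`C(p^r(m₁+m₂) − p^s k, p^r m₁)/C(p^{r−1}(m₁+m₂) − p^{s−1} k, p^{r−1} m₁) ≡ 1 (mod p^{r+2min(r,s)})`.
Consequently, (42) `A_λ(p^r 𝐧; p^s k) = c A_λ(p^{r−1} 𝐧; p^{s−1} k)` with `c ≡ 1` modulo `p^{r+2min(r,s)}`.
If `s ≥ r`, this proves congruence (40) with `α = 3`. On the other hand, suppose `s ≤ r`. Since `p ∤ k`, we have
`C(p^r n, p^s k) = p^{r−s} (n/k) C(p^r n − 1, p^s k − 1) ≡ 0 (mod p^{r−s})`. Since `ℓ ≥ 2`, it follows that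
`p^{2(r−s)}` divides `A_λ(p^r 𝐧; p^s k)`. Since `(r + 2s) + 2(r − s) = 3r`, the congruence … now follows.»

## Dictionary

«`X/Y ≡ 1 (mod p^N)`» for natural numbers `X, Y` is rendered by the UNIT-RATIO RELATION
`∃ x y, p ∤ y ∧ y·X = x·Y ∧ x ≡ y (mod p^N)` (the shape of the tree's `Jacobsthal.exists_ratio`; it also covers
the degenerate cases `X = Y = 0` and `X = Y = 1`); `modEq_of_ratio` turns it, together with `p^e ∣ Y`, into
`X ≡ Y (mod p^{N+e})`. For λ = (2,2) and `𝐧 ∈ ℤ_{≥0}^4` the summand (39) is, as in the tree's `straubA`,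
`A(𝐦; K) = C(m₁, K) C(m₃, K) C(m₁ + m₂ − K, m₁) C(m₃ + m₄ − K, m₃)`.

* `ratio_choose` — the `λ_j = 1` factor, modulus `p^{r+s+min(r,s)}`; `ratio_choose_sub` — the second binomial of
  a `λ_j = 2` factor, modulus `p^{r+2min(r,s)}` (both from `Jacobsthal.exists_ratio` with the valuation counts of
  the printed proof); `pow_sub_dvd_choose` — `p^{R−S} ∣ C(p^R m, p^S k)`; **`term_modEq`** — (40) for λ = (2,2).
-/

open Finset

namespace Literature.Combinatorics.Enumerative.MultivariateAperyPrimePowerProofs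

open Literature.NumberTheory.Congruences (Jacobsthal.exists_ratio)

section Ratio

variable {p : ℕ} [hp : Fact p.Prime]

/-- Unit-ratio relations multiply. [folklore] -/
private theorem ratio_mul {N A A' B B' : ℕ}
    (hA : ∃ x y : ℕ, ¬ p ∣ y ∧ y * A = x * A' ∧ x ≡ y [MOD p ^ N])
    (hB : ∃ x y : ℕ, ¬ p ∣ y ∧ y * B = x * B' ∧ x ≡ y [MOD p ^ N]) :
    ∃ x y : ℕ, ¬ p ∣ y ∧ y * (A * B) = x * (A' * B') ∧ x ≡ y [MOD p ^ N] := by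
  obtain ⟨x₁, y₁, hy₁, h₁, hm₁⟩ := hA
  obtain ⟨x₂, y₂, hy₂, h₂, hm₂⟩ := hB
  refine ⟨x₁ * x₂, y₁ * y₂, fun h => ?_, ?_, hm₁.mul hm₂⟩
  · rcases (Nat.Prime.dvd_mul hp.out).mp h with h | h
    · exact hy₁ h
    · exact hy₂ h
  · calc y₁ * y₂ * (A * B) = (y₁ * A) * (y₂ * B) := by ring
      _ = (x₁ * A') * (x₂ * B') := by rw [h₁, h₂]
      _ = x₁ * x₂ * (A' * B') := by ring

omit hp in
/-- Unit-ratio relations weaken to smaller moduli. [folklore] -/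
private theorem ratio_of_le {N N' A A' : ℕ} (hN : N' ≤ N)
    (hA : ∃ x y : ℕ, ¬ p ∣ y ∧ y * A = x * A' ∧ x ≡ y [MOD p ^ N]) :
    ∃ x y : ℕ, ¬ p ∣ y ∧ y * A = x * A' ∧ x ≡ y [MOD p ^ N'] := by
  obtain ⟨x, y, hy, h, hm⟩ := hA
  exact ⟨x, y, hy, h, hm.of_dvd (pow_dvd_pow p hN)⟩

/-- The trivial unit-ratio relation between equal numbers. [folklore] -/
private theorem ratio_refl {N A : ℕ} : ∃ x y : ℕ, ¬ p ∣ y ∧ y * A = x * A ∧ x ≡ y [MOD p ^ N] :=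
  ⟨1, 1, fun h => hp.out.one_lt.ne' (Nat.eq_one_of_dvd_one h), rfl, Nat.ModEq.refl 1⟩

/-- **From a unit ratio to a congruence**: if `A/A'` is a `p`-adic unit `≡ 1 (mod p^N)` and `p^e ∣ A'`,
then `A ≡ A' (mod p^{N+e})` («`A = cA'` with `c ≡ 1` … in light of `p^{2(r−s)}` dividing `A` …»).
[cite: Straub2014, Lemma 5.3 (proof)] -/
theorem modEq_of_ratio {N e A A' : ℕ} (hA : ∃ x y : ℕ, ¬ p ∣ y ∧ y * A = x * A' ∧ x ≡ y [MOD p ^ N])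
    (he : p ^ e ∣ A') : (A : ℤ) ≡ A' [ZMOD (p : ℤ) ^ (N + e)] := by
  have hp' := hp.out
  obtain ⟨x, y, hy, h, hm⟩ := hA
  have hid : (y : ℤ) * ((A : ℤ) - A') = ((x : ℤ) - y) * A' := by
    have := congrArg (Nat.cast : ℕ → ℤ) h
    push_cast at this
    linear_combination this
  have h1 : (p : ℤ) ^ N ∣ (x : ℤ) - y := by
    have := Nat.modEq_iff_dvd.mp hm.symm
    simpa using this
  have h2 : (p : ℤ) ^ e ∣ (A' : ℤ) := by exact_mod_cast he
  have h12 : (p : ℤ) ^ (N + e) ∣ (y : ℤ) * ((A : ℤ) - A') := by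
    rw [hid, pow_add]; exact mul_dvd_mul h1 h2
  have hcop : IsCoprime ((p : ℤ) ^ (N + e)) (y : ℤ) := by
    have hc : Nat.Coprime (p ^ (N + e)) y := Nat.Coprime.pow_left _ ((Nat.Prime.coprime_iff_not_dvd hp').mpr hy)
    have := Nat.isCoprime_iff_coprime.mpr hc
    push_cast at this
    exact this
  exact (Int.ModEq.symm ((Int.modEq_iff_dvd.mpr (hcop.dvd_of_dvd_mul_left h12)))).symm.symm

/-- `p^{min(r,s) − 1}`-type valuation bound: if `p^t ∣ a` with `a ≠ 0` then `t ≤ v_p(a)`. [folklore] -/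
private theorem le_padicValNat_of_pow_dvd {t a : ℕ} (ha : a ≠ 0) (h : p ^ t ∣ a) : t ≤ padicValNat p a :=
  (padicValNat_dvd_iff_le ha).mp h

/-- **Jacobsthal for the `λ_j = 1` factor** (Straub, proof of Lemma 5.3): for `p ≥ 5`, `r, s ≥ 1`, `p ∤ k`,
`k ≥ 1` and every `m`, `C(p^r m, p^s k)/C(p^{r−1} m, p^{s−1} k) ≡ 1 (mod p^{r+s+min(r,s)})` as a unit
ratio (both sides vanish or equal `1` in the degenerate cases). [cite: Straub2014, Lemma 5.3 (proof)] -/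
theorem ratio_choose (h3 : 3 < p) {r s : ℕ} (hr : 1 ≤ r) (hs : 1 ≤ s) {k : ℕ} (hk : 1 ≤ k) (m : ℕ) :
    ∃ x y : ℕ, ¬ p ∣ y ∧ y * (p ^ r * m).choose (p ^ s * k) = x * (p ^ (r - 1) * m).choose (p ^ (s - 1) * k) ∧
      x ≡ y [MOD p ^ (r + s + min r s)] := by
  have hp' := hp.out
  set a := p ^ (r - 1) * m with ha
  set b := p ^ (s - 1) * k with hb
  have hap : p ^ r * m = a * p := by
    rw [ha, mul_comm (p ^ (r - 1) * m) p, ← mul_assoc, ← pow_succ', Nat.sub_add_cancel hr]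
  have hbp : p ^ s * k = b * p := by
    rw [hb, mul_comm (p ^ (s - 1) * k) p, ← mul_assoc, ← pow_succ', Nat.sub_add_cancel hs]
  rw [hap, hbp]
  rcases Nat.lt_or_ge b a with hba | hab
  · -- the generic case `0 < b < a`
    have hb0 : b ≠ 0 := Nat.mul_ne_zero (pow_ne_zero _ hp'.ne_zero) (by omega)
    have ha0 : a ≠ 0 := by omega
    have hva : r - 1 ≤ padicValNat p a := le_padicValNat_of_pow_dvd ha0 (Dvd.intro m rfl)
    have hvb : s - 1 ≤ padicValNat p b := le_padicValNat_of_pow_dvd hb0 (Dvd.intro k rfl)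
    have hvab : min r s - 1 ≤ padicValNat p (a - b) := by
      refine le_padicValNat_of_pow_dvd (by omega) (Nat.dvd_sub ?_ ?_)
      · exact (pow_dvd_pow p (by omega)).trans (Dvd.intro m rfl)
      · exact (pow_dvd_pow p (by omega)).trans (Dvd.intro k rfl)
    exact ratio_of_le (by omega) (Jacobsthal.exists_ratio (p := p) h3 a b)
  · rcases hab.eq_or_lt with hab | hab
    · rw [hab, Nat.choose_self, Nat.choose_self]
      exact ratio_refl
    · rw [Nat.choose_eq_zero_of_lt hab, Nat.choose_eq_zero_of_lt ((Nat.mul_lt_mul_right hp'.pos).mpr hab)]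
      exact ratio_refl

/-- **Jacobsthal for the second binomial of a `λ_j = 2` factor** (Straub, proof of Lemma 5.3): for `p ≥ 5`,
`r, s ≥ 1`, `p ∤ k`, `k ≥ 1`, `C(p^r(m₁+m₂) − p^s k, p^r m₁)/C(p^{r−1}(m₁+m₂) − p^{s−1} k, p^{r−1} m₁) ≡ 1
(mod p^{r + 2 min(r,s)})` as a unit ratio. [cite: Straub2014, Lemma 5.3 (proof)] -/
theorem ratio_choose_sub (h3 : 3 < p) {r s : ℕ} (hr : 1 ≤ r) (hs : 1 ≤ s) (k m₁ m₂ : ℕ) :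
    ∃ x y : ℕ, ¬ p ∣ y ∧ y * (p ^ r * m₁ + p ^ r * m₂ - p ^ s * k).choose (p ^ r * m₁) =
      x * (p ^ (r - 1) * m₁ + p ^ (r - 1) * m₂ - p ^ (s - 1) * k).choose (p ^ (r - 1) * m₁) ∧
      x ≡ y [MOD p ^ (r + 2 * min r s)] := by
  have hp' := hp.out
  set a := p ^ (r - 1) * m₁ + p ^ (r - 1) * m₂ - p ^ (s - 1) * k with ha
  set b := p ^ (r - 1) * m₁ with hb
  have hpow : ∀ {t : ℕ}, 1 ≤ t → ∀ n : ℕ, p ^ t * n = p ^ (t - 1) * n * p := fun {t} ht n => by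
    rw [mul_comm (p ^ (t - 1) * n) p, ← mul_assoc, ← pow_succ', Nat.sub_add_cancel ht]
  have hap : p ^ r * m₁ + p ^ r * m₂ - p ^ s * k = a * p := by
    rw [hpow hr, hpow hr, hpow hs, ha, Nat.sub_mul, Nat.add_mul]
  have hbp : p ^ r * m₁ = b * p := hpow hr m₁
  rw [hap, hbp]
  rcases Nat.eq_zero_or_pos b with hb0 | hb0
  · rw [hb0, zero_mul, Nat.choose_zero_right, Nat.choose_zero_right]; exact ratio_refl
  rcases Nat.lt_or_ge b a with hba | hab
  · have ha0 : a ≠ 0 := by omega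
    have hmin : p ^ (min r s - 1) ∣ p ^ (r - 1) := pow_dvd_pow p (by omega)
    have hmin' : p ^ (min r s - 1) ∣ p ^ (s - 1) := pow_dvd_pow p (by omega)
    have hva : min r s - 1 ≤ padicValNat p a := by
      refine le_padicValNat_of_pow_dvd ha0 (Nat.dvd_sub (dvd_add ?_ ?_) ?_)
      · exact hmin.trans (Dvd.intro m₁ rfl)
      · exact hmin.trans (Dvd.intro m₂ rfl)
      · exact hmin'.trans (Dvd.intro k rfl)
    have hvb : r - 1 ≤ padicValNat p b := le_padicValNat_of_pow_dvd (by omega) (Dvd.intro m₁ rfl)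
    have hvab : min r s - 1 ≤ padicValNat p (a - b) := by
      refine le_padicValNat_of_pow_dvd (by omega) (Nat.dvd_sub (Nat.dvd_sub (dvd_add ?_ ?_) ?_) ?_)
      · exact hmin.trans (Dvd.intro m₁ rfl)
      · exact hmin.trans (Dvd.intro m₂ rfl)
      · exact hmin'.trans (Dvd.intro k rfl)
      · exact hmin.trans (Dvd.intro m₁ rfl)
    exact ratio_of_le (by omega) (Jacobsthal.exists_ratio (p := p) h3 a b)
  · rcases hab.eq_or_lt with hab | hab
    · rw [← hab, Nat.choose_self, Nat.choose_self]; exact ratio_refl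
    · rw [Nat.choose_eq_zero_of_lt hab, Nat.choose_eq_zero_of_lt ((Nat.mul_lt_mul_right hp'.pos).mpr hab)]
      exact ratio_refl

/-- `p^{R−S} ∣ C(p^R m, p^S k)` for `S ≤ R`, `p ∤ k`, `k ≥ 1` («since `p ∤ k`, we have
`C(p^r n, p^s k) = p^{r−s} (n/k) C(p^r n − 1, p^s k − 1) ≡ 0 (mod p^{r−s})`»). [cite: Straub2014, Lemma 5.3 (proof)] -/
theorem pow_sub_dvd_choose {R S : ℕ} (hSR : S ≤ R) {k : ℕ} (hk : 1 ≤ k) (hpk : ¬ p ∣ k) (m : ℕ) :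
    p ^ (R - S) ∣ (p ^ R * m).choose (p ^ S * k) := by
  have hp' := hp.out
  by_cases hC : (p ^ R * m).choose (p ^ S * k) = 0
  · rw [hC]; exact dvd_zero _
  have hm : m ≠ 0 := by
    rintro rfl
    rw [mul_zero, Nat.choose_eq_zero_of_lt (Nat.mul_pos (pow_pos hp'.pos S) hk)] at hC
    exact hC rfl
  have hK : 1 ≤ p ^ S * k := Nat.mul_pos (pow_pos hp'.pos S) hk
  -- `p^S k · C(p^R m, p^S k) = p^R m · C(p^R m − 1, p^S k − 1)`
  have hid : p ^ R * m * ((p ^ R * m - 1).choose (p ^ S * k - 1)) = (p ^ R * m).choose (p ^ S * k) * (p ^ S * k) := by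
    have h := Nat.add_one_mul_choose_eq (p ^ R * m - 1) (p ^ S * k - 1)
    have h1 : 1 ≤ p ^ R * m := Nat.mul_pos (pow_pos hp'.pos R) (Nat.pos_of_ne_zero hm)
    rwa [Nat.sub_add_cancel h1, Nat.sub_add_cancel hK] at h
  have hC' : (p ^ R * m - 1).choose (p ^ S * k - 1) ≠ 0 := by
    intro h0
    rw [h0, mul_zero] at hid
    exact hC ((mul_eq_zero.mp hid.symm).resolve_right (by omega))
  have hv := congrArg (padicValNat p) hid
  rw [padicValNat.mul (Nat.mul_ne_zero (pow_ne_zero _ hp'.ne_zero) hm) hC',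
    padicValNat.mul (pow_ne_zero _ hp'.ne_zero) hm, padicValNat.prime_pow,
    padicValNat.mul hC (by omega), padicValNat.mul (pow_ne_zero _ hp'.ne_zero) (by omega),
    padicValNat.prime_pow, padicValNat.eq_zero_of_not_dvd hpk] at hv
  rw [padicValNat_dvd_iff_le hC]
  omega

/-- **Straub 2014, Lemma 5.3, (40), for λ = (2,2) and `𝐧 ∈ ℤ_{≥0}^4`**: for a prime `p ≥ 5`, `r, s ≥ 1`
and `p ∤ k`, `k ≥ 1`, `A(p^r 𝐧; p^s k) ≡ A(p^{r−1} 𝐧; p^{s−1} k) (mod p^{3r})`, where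
`A(𝐦; K) = C(m₁, K) C(m₃, K) C(m₁+m₂−K, m₁) C(m₃+m₄−K, m₃)`. [cite: Straub2014, Lemma 5.3 (40)] -/
theorem term_modEq (h3 : 3 < p) {r s : ℕ} (hr : 1 ≤ r) (hs : 1 ≤ s) {k : ℕ} (hk : 1 ≤ k) (hpk : ¬ p ∣ k)
    (n₁ n₂ n₃ n₄ : ℕ) :
    (((p ^ r * n₁).choose (p ^ s * k) * (p ^ r * n₃).choose (p ^ s * k) *
        (p ^ r * n₁ + p ^ r * n₂ - p ^ s * k).choose (p ^ r * n₁) *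
        (p ^ r * n₃ + p ^ r * n₄ - p ^ s * k).choose (p ^ r * n₃) : ℕ) : ℤ) ≡
      (((p ^ (r - 1) * n₁).choose (p ^ (s - 1) * k) * (p ^ (r - 1) * n₃).choose (p ^ (s - 1) * k) *
        (p ^ (r - 1) * n₁ + p ^ (r - 1) * n₂ - p ^ (s - 1) * k).choose (p ^ (r - 1) * n₁) *
        (p ^ (r - 1) * n₃ + p ^ (r - 1) * n₄ - p ^ (s - 1) * k).choose (p ^ (r - 1) * n₃) : ℕ) : ℤ)
      [ZMOD (p : ℤ) ^ (3 * r)] := by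
  have hle : r + 2 * min r s ≤ r + s + min r s := by omega
  have h1 := ratio_of_le hle (ratio_choose (p := p) h3 hr hs hk n₁)
  have h3' := ratio_of_le hle (ratio_choose (p := p) h3 hr hs hk n₃)
  have h2 := ratio_choose_sub (p := p) h3 hr hs k n₁ n₂
  have h4 := ratio_choose_sub (p := p) h3 hr hs k n₃ n₄
  have hall := ratio_mul (ratio_mul (ratio_mul h1 h3') h2) h4
  -- the extra divisibility `p^{2(r−s)} ∣ A(p^{r−1} 𝐧; p^{s−1} k)` when `s < r`
  have hdiv : p ^ (2 * (r - s)) ∣ (p ^ (r - 1) * n₁).choose (p ^ (s - 1) * k) *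
      (p ^ (r - 1) * n₃).choose (p ^ (s - 1) * k) *
      (p ^ (r - 1) * n₁ + p ^ (r - 1) * n₂ - p ^ (s - 1) * k).choose (p ^ (r - 1) * n₁) *
      (p ^ (r - 1) * n₃ + p ^ (r - 1) * n₄ - p ^ (s - 1) * k).choose (p ^ (r - 1) * n₃) := by
    rcases Nat.lt_or_ge s r with hsr | hrs
    swap
    · rw [show r - s = 0 by omega, mul_zero, pow_zero]; exact one_dvd _
    · have h := mul_dvd_mul (pow_sub_dvd_choose (p := p) (show s - 1 ≤ r - 1 by omega) hk hpk n₁)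
        (pow_sub_dvd_choose (p := p) (show s - 1 ≤ r - 1 by omega) hk hpk n₃)
      rw [← pow_add, show r - 1 - (s - 1) + (r - 1 - (s - 1)) = 2 * (r - s) by omega] at h
      exact (h.mul_right _).mul_right _
  have := modEq_of_ratio hall hdiv
  rw [show r + 2 * min r s + 2 * (r - s) = 3 * r by omega] at this
  exact this

end Ratio

end Literature.Combinatorics.Enumerative.MultivariateAperyPrimePowerProofs
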